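import Summits.QuantumAdvantage.AdviceFreeQNC0.LinFormsMain
import HarnessLib

/-!
# Rung R11' `WalkHardFLinForms p`: strategies reading the input only through polylog many linear forms mod `p` lose (every prime `p ≠ 3`)

Planner qa-qnc0-p2 g15/g16, ROUND-15 (p2) §3.11 (def VERBATIM from `line15/Sketch15R7.lean`): a strategy for α's u-walk game
`y_g(u) = tab g (V u)` reading the input ONLY through the residue vector `V(u) ∈ (ℤ/p)^K` of `K ≤ (log₂ n)^C` linear forms mod `p`
(dense, high fan-in forms; ARBITRARY tables) wins on at most `θ·2ⁿ` inputs.  This is the first rung beyond juntas/locality: it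
covers the "counter-like" strategies of the dense residual.

PROOF (conditioning-free form of the regularise–expand argument, PROVER3-MEMO-gen9 §4).  Junta set `J` (`exists_regular_span`,
`|J| ≤ K·w`), junta subgroup `Γ = {γ : β(γ) supported in J}` and `Γ^⊥`; split the cell indicator
`[V u = v] = p^{-K}|Γ|·[V u − v ⊥ Γ] + p^{-K}Σ_{γ ∉ Γ} χ(⟨γ, V u − v⟩)` (`ite_eq_zero_split`).  MAIN: the junta cells re-index
into the `J`-junta strategies `z_δ` (`main_term_le`, `|Γ||Γ^⊥| = p^K`) ⇒ `≤ θ_J·2ⁿ` by qn-prover g10's `walkHardFJunta`.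
ERROR: for `γ ∉ Γ` the form `β(γ)` has `≥ w` non-zeros (regularity), and `Σ_u χ(⟨β(γ),u⟩)[WIN_{Y_v}(u)]` is a twisted sum of the
CONSTANT strategy `Y_v` ⇒ `≤ 3√6·ρ^w·2ⁿ` by `twistBound` (`ρ = cos(π/3p)`, qn-lit g18's two-moduli non-resonance); in total
`≤ 3√6·p^K·ρ^w·2ⁿ`.  Parameters: `ρ^m < 1/p`, `3√6ρ^{m₀} ≤ (1−θ_J)/2`, `w = K·m + m₀`.
Main results: `walkHardFLinForms (p) (hp3 : p ≠ 3) : WalkHardFLinForms p` (and the quantitative `LinForms.card_win_le`).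
WHAT THIS IS NOT: the dense residual with MANY forms (one counter per cut, VPE-lin) or non-linear high-fan-in tests is
untouched; false for `p = 3`; rung F-Q2-odd instrument; separation NOT moved.
-/

noncomputable section

namespace Summit.QuantumAdvantage.AdviceFreeQNC0

open Finset

/-- **`WalkHardFLinForms p`** (R11'; planner qa-qnc0-p2 g15 Sketch15R7, verbatim): a strategy that reads the input only through
the values mod `p` of `K ≤ (log₂ n)^C` linear forms, `y_g(u) = tab g (fun j ↦ Σ_{i : u_i} λ_{j,i})`, wins on at most `θ·2ⁿ` inputs. -/
def WalkHardFLinForms (p : ℕ) [Fact p.Prime] : Prop :=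
  ∃ θ : ℝ, θ < 1 ∧ ∀ C : ℕ, ∃ n₀ : ℕ, ∀ n ≥ n₀, ∀ c K : ℕ, K ≤ (Nat.log 2 n) ^ C →
    ∀ (lam : Fin K → Fin n → ZMod p) (tab : Fin (n + 1) → (Fin K → ZMod p) → Bool),
      ((Finset.univ.filter fun u : Fin n → Bool =>
          ringWinU c (fun g v => tab g (fun j => ∑ i, (if v i then lam j i else 0))) u
            = true).card : ℝ) ≤ θ * (2 : ℝ) ^ n

namespace LinForms

variable {n K : ℕ} {p : ℕ} [Fact p.Prime]

/-- The twisted term of a dual vector `γ` and a cell `v`, with the shift pulled out: unit-modulus factor times the twisted sum of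
the constant strategy `Y_v` against the form `β(γ)`. -/
theorem norm_sum_char_shift (c : ℕ) (lam : Fin K → Fin n → ZMod p) (tab : Fin (n + 1) → (Fin K → ZMod p) → Bool)
    (γ v : Fin K → ZMod p) :
    ‖∑ u : Fin n → Bool, (ZMod.stdAddChar (dot γ (resVec lam u - v)) : ℂ) * winC c tab v u‖ =
      ‖∑ u : Fin n → Bool, (ZMod.stdAddChar (∑ i : Fin n, if u i then ∑ j, γ j * lam j i else 0) : ℂ) * winC c tab v u‖ := by
  have h : ∀ u : Fin n → Bool, (ZMod.stdAddChar (dot γ (resVec lam u - v)) : ℂ) =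
      (ZMod.stdAddChar (∑ i : Fin n, if u i then ∑ j, γ j * lam j i else 0) : ℂ) * ZMod.stdAddChar (dot γ (-v)) := by
    intro u
    rw [sub_eq_add_neg, dot_add_right, AddChar.map_add_eq_mul]
    congr 2
    unfold dot resVec
    exact Literature.Computability.MetaComplexity.TwoModuli.sum_mul_linForms_eq γ lam u
  simp_rw [h]
  rw [show (∑ u : Fin n → Bool, (ZMod.stdAddChar (∑ i : Fin n, if u i then ∑ j, γ j * lam j i else 0) : ℂ) *
      ZMod.stdAddChar (dot γ (-v)) * winC c tab v u) = ZMod.stdAddChar (dot γ (-v)) *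
      ∑ u : Fin n → Bool, (ZMod.stdAddChar (∑ i : Fin n, if u i then ∑ j, γ j * lam j i else 0) : ℂ) * winC c tab v u from by
    rw [Finset.mul_sum]; exact Finset.sum_congr rfl fun u _ => by ring]
  rw [norm_mul, AddChar.norm_apply, one_mul]

/-- **Quantitative R11'**: with a `w`-regular junta set `J` for the forms and a bound `θ` for all `J`-junta strategies,
`#win ≤ θ·2ⁿ + 3√6·p^K·cos(π/(3p))^w·2ⁿ`. -/
theorem card_win_le (hp3 : p ≠ 3) (c : ℕ) (lam : Fin K → Fin n → ZMod p) (tab : Fin (n + 1) → (Fin K → ZMod p) → Bool)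
    (J : Finset (Fin n)) {w : ℕ} (hreg : Regular (Submodule.span (ZMod p) (Set.range lam)) w J) {θ : ℝ}
    (hJ : ∀ y : Fin (n + 1) → (Fin n → Bool) → Bool, (∀ g, ∀ u v : Fin n → Bool, (∀ i ∈ J, u i = v i) → y g u = y g v) →
      ((univ.filter fun u : Fin n → Bool => ringWinU c y u = true).card : ℝ) ≤ θ * (2 : ℝ) ^ n) :
    ((univ.filter fun u : Fin n → Bool =>
        ringWinU c (fun g v => tab g (fun j => ∑ i, if v i then lam j i else 0)) u = true).card : ℝ) ≤
      θ * (2 : ℝ) ^ n + 3 * Real.sqrt 6 * (p : ℝ) ^ K * Real.cos (Real.pi / (3 * p)) ^ w * (2 : ℝ) ^ n := by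
  classical
  set ρ : ℝ := Real.cos (Real.pi / (3 * p)) with hρ
  have hp2 : 2 ≤ p := (Fact.out : p.Prime).two_le
  have hρ0 : 0 ≤ ρ := by
    apply Real.cos_nonneg_of_neg_pi_div_two_le_of_le
    · have : 0 ≤ Real.pi / (3 * p) := by positivity
      linarith [Real.pi_pos]
    · rw [div_le_div_iff₀ (by positivity) (by norm_num)]
      have : (2 : ℝ) ≤ p := by exact_mod_cast hp2
      nlinarith [Real.pi_pos]
  have hρ1 : ρ ≤ 1 := Real.cos_le_one _
  set Γ := gammaJ lam J with hΓ
  set E : ℝ := 3 * Real.sqrt 6 * ρ ^ w * (2 : ℝ) ^ n with hE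
  have hE0 : 0 ≤ E := by positivity
  -- regularity: forms outside `Γ` have ≥ w non-zeros
  have hsupp : ∀ γ : Fin K → ZMod p, γ ∉ Γ → w ≤ (univ.filter fun i : Fin n => (∑ j, γ j * lam j i) ≠ 0).card := by
    intro γ hγ
    by_contra hlt
    push Not at hlt
    apply hγ
    rw [hΓ, mem_gammaJ]
    have hmem : (fun i => ∑ j, γ j * lam j i) ∈ Submodule.span (ZMod p) (Set.range lam) := by
      have : (fun i => ∑ j, γ j * lam j i) = ∑ j, γ j • lam j := by
        funext i; simp [Finset.sum_apply, Pi.smul_apply, smul_eq_mul]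
      rw [this]
      exact Submodule.sum_mem _ fun j _ => Submodule.smul_mem _ _ (Submodule.subset_span ⟨j, rfl⟩)
    have hout : (outSupp J (fun i => ∑ j, γ j * lam j i)).card < w :=
      lt_of_le_of_lt (Finset.card_le_card (fun i hi => by
        unfold outSupp at hi; rw [mem_filter] at hi ⊢; exact ⟨hi.1, hi.2.2⟩)) hlt
    exact hreg _ hmem hout
  -- per-cell twisted terms
  have hterm : ∀ (v γ : Fin K → ZMod p), γ ∉ Γ →
      ‖∑ u : Fin n → Bool, (ZMod.stdAddChar (dot γ (resVec lam u - v)) : ℂ) * winC c tab v u‖ ≤ E := by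
    intro v γ hγ
    rw [norm_sum_char_shift]
    refine (norm_twisted_le hp3 c tab v _).trans ?_
    have : ρ ^ (univ.filter fun i : Fin n => (∑ j, γ j * lam j i) ≠ 0).card ≤ ρ ^ w :=
      pow_le_pow_of_le_one hρ0 hρ1 (hsupp γ hγ)
    rw [hE]
    have h6 : 0 ≤ 3 * Real.sqrt 6 := by positivity
    have h2n : (0 : ℝ) ≤ (2 : ℝ) ^ n := by positivity
    nlinarith [mul_nonneg h6 h2n]
  -- the split of every cell
  have hsplit : ∀ (v : Fin K → ZMod p) (u : Fin n → Bool),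
      (if (fun j => ∑ i, if u i then lam j i else 0) = v then winC c tab v u else 0) =
        ((p : ℂ) ^ K)⁻¹ * (Γ.card : ℂ) *
          (if (∀ γ ∈ Γ, dot γ (resVec lam u - v) = 0) then winC c tab v u else 0) +
        ((p : ℂ) ^ K)⁻¹ * ∑ γ ∈ univ.filter (fun γ => γ ∉ Γ),
          (ZMod.stdAddChar (dot γ (resVec lam u - v)) : ℂ) * winC c tab v u := by
    intro v u
    have h1 : (if (fun j => ∑ i, if u i then lam j i else 0) = v then winC c tab v u else 0) =
        (if resVec lam u - v = 0 then (1 : ℂ) else 0) * winC c tab v u := by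
      change (if resVec lam u = v then winC c tab v u else 0) = _
      by_cases hv : resVec lam u = v
      · rw [if_pos hv, if_pos (sub_eq_zero.mpr hv), one_mul]
      · rw [if_neg hv, if_neg (fun h => hv (sub_eq_zero.mp h)), zero_mul]
    rw [h1, ite_eq_zero_split lam J (resVec lam u - v), add_mul]
    congr 1
    · split_ifs <;> ring
    · rw [mul_assoc, Finset.sum_mul]
  -- assemble
  have hmain := main_term_le lam J c tab hJ
  have hcardId := card_gammaJ_mul_card_perp lam J
  have hpK : (p : ℝ) ^ K ≠ 0 := pow_ne_zero _ (by exact_mod_cast (Fact.out : p.Prime).ne_zero)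
  have hpKc : ((p : ℂ) ^ K) ≠ 0 := pow_ne_zero _ (by exact_mod_cast (Fact.out : p.Prime).ne_zero)
  have htot := card_win_eq_sum_cells c lam tab
  -- rewrite the total as main + error
  have hdecomp : (∑ v : Fin K → ZMod p, ∑ u : Fin n → Bool,
      (if (fun j => ∑ i, if u i then lam j i else 0) = v then winC c tab v u else 0)) =
      ((p : ℂ) ^ K)⁻¹ * (Γ.card : ℂ) * (∑ v : Fin K → ZMod p, ∑ u : Fin n → Bool,
        (if (∀ γ ∈ Γ, dot γ (resVec lam u - v) = 0) then winC c tab v u else 0)) +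
      ((p : ℂ) ^ K)⁻¹ * ∑ v : Fin K → ZMod p, ∑ γ ∈ univ.filter (fun γ => γ ∉ Γ),
        ∑ u : Fin n → Bool, (ZMod.stdAddChar (dot γ (resVec lam u - v)) : ℂ) * winC c tab v u := by
    simp_rw [hsplit, Finset.sum_add_distrib]
    congr 1
    · rw [Finset.mul_sum]
      refine Finset.sum_congr rfl fun v _ => ?_
      rw [Finset.mul_sum]
    · rw [Finset.mul_sum]
      refine Finset.sum_congr rfl fun v _ => ?_
      rw [← Finset.mul_sum, Finset.sum_comm]
  have herr : ‖∑ v : Fin K → ZMod p, ∑ γ ∈ univ.filter (fun γ => γ ∉ Γ),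
      ∑ u : Fin n → Bool, (ZMod.stdAddChar (dot γ (resVec lam u - v)) : ℂ) * winC c tab v u‖ ≤
      (p : ℝ) ^ K * ((p : ℝ) ^ K * E) := by
    refine (norm_sum_le _ _).trans ?_
    have hv : ∀ v : Fin K → ZMod p, ‖∑ γ ∈ univ.filter (fun γ => γ ∉ Γ),
        ∑ u : Fin n → Bool, (ZMod.stdAddChar (dot γ (resVec lam u - v)) : ℂ) * winC c tab v u‖ ≤ (p : ℝ) ^ K * E := by
      intro v
      refine (norm_sum_le _ _).trans ?_
      calc (∑ γ ∈ univ.filter (fun γ => γ ∉ Γ),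
            ‖∑ u : Fin n → Bool, (ZMod.stdAddChar (dot γ (resVec lam u - v)) : ℂ) * winC c tab v u‖)
          ≤ ∑ γ ∈ univ.filter (fun γ => γ ∉ Γ), E := Finset.sum_le_sum fun γ hγ => hterm v γ (mem_filter.1 hγ).2
        _ ≤ (p : ℝ) ^ K * E := by
            rw [Finset.sum_const, nsmul_eq_mul]
            have : ((univ.filter (fun γ : Fin K → ZMod p => γ ∉ Γ)).card : ℝ) ≤ (p : ℝ) ^ K := by
              have h1 := Finset.card_filter_le (univ : Finset (Fin K → ZMod p)) (fun γ => γ ∉ Γ)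
              rw [Finset.card_univ, Fintype.card_fun, ZMod.card, Fintype.card_fin] at h1
              exact_mod_cast h1
            nlinarith
    calc (∑ v : Fin K → ZMod p, ‖∑ γ ∈ univ.filter (fun γ => γ ∉ Γ),
          ∑ u : Fin n → Bool, (ZMod.stdAddChar (dot γ (resVec lam u - v)) : ℂ) * winC c tab v u‖)
        ≤ ∑ _v : Fin K → ZMod p, (p : ℝ) ^ K * E := Finset.sum_le_sum fun v _ => hv v
      _ = (p : ℝ) ^ K * ((p : ℝ) ^ K * E) := by
          rw [Finset.sum_const, nsmul_eq_mul, Finset.card_univ, Fintype.card_fun, ZMod.card, Fintype.card_fin]; push_cast; ring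
  -- norms
  have hnorm : ((univ.filter fun u : Fin n → Bool =>
        ringWinU c (fun g v => tab g (fun j => ∑ i, if v i then lam j i else 0)) u = true).card : ℝ) =
      ‖(((univ.filter fun u : Fin n → Bool =>
        ringWinU c (fun g v => tab g (fun j => ∑ i, if v i then lam j i else 0)) u = true).card : ℕ) : ℂ)‖ := by
    rw [Complex.norm_natCast]
  rw [hnorm, htot, hdecomp]
  refine (norm_add_le _ _).trans ?_
  have hA : ‖((p : ℂ) ^ K)⁻¹ * (Γ.card : ℂ) * (∑ v : Fin K → ZMod p, ∑ u : Fin n → Bool,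
      (if (∀ γ ∈ Γ, dot γ (resVec lam u - v) = 0) then winC c tab v u else 0))‖ ≤ θ * (2 : ℝ) ^ n := by
    rw [norm_mul, norm_mul, norm_inv, norm_pow, Complex.norm_natCast, Complex.norm_natCast]
    calc ((p : ℝ) ^ K)⁻¹ * (Γ.card : ℝ) * ‖∑ v : Fin K → ZMod p, ∑ u : Fin n → Bool,
          (if (∀ γ ∈ Γ, dot γ (resVec lam u - v) = 0) then winC c tab v u else 0)‖
        ≤ ((p : ℝ) ^ K)⁻¹ * (Γ.card : ℝ) * (((perp lam J).card : ℝ) * (θ * (2 : ℝ) ^ n)) :=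
          mul_le_mul_of_nonneg_left hmain (by positivity)
      _ = (((p : ℝ) ^ K)⁻¹ * ((Γ.card : ℝ) * ((perp lam J).card : ℝ))) * (θ * (2 : ℝ) ^ n) := by ring
      _ = θ * (2 : ℝ) ^ n := by
          have hnat : Γ.card * (perp lam J).card = p ^ K := by
            have h := hcardId; exact_mod_cast h
          have hreal : (Γ.card : ℝ) * ((perp lam J).card : ℝ) = (p : ℝ) ^ K := by exact_mod_cast hnat
          rw [hreal, inv_mul_cancel₀ hpK, one_mul]
  have hB : ‖((p : ℂ) ^ K)⁻¹ * ∑ v : Fin K → ZMod p, ∑ γ ∈ univ.filter (fun γ => γ ∉ Γ),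
      ∑ u : Fin n → Bool, (ZMod.stdAddChar (dot γ (resVec lam u - v)) : ℂ) * winC c tab v u‖ ≤ (p : ℝ) ^ K * E := by
    rw [norm_mul, norm_inv, norm_pow, Complex.norm_natCast]
    calc ((p : ℝ) ^ K)⁻¹ * ‖∑ v : Fin K → ZMod p, ∑ γ ∈ univ.filter (fun γ => γ ∉ Γ),
          ∑ u : Fin n → Bool, (ZMod.stdAddChar (dot γ (resVec lam u - v)) : ℂ) * winC c tab v u‖
        ≤ ((p : ℝ) ^ K)⁻¹ * ((p : ℝ) ^ K * ((p : ℝ) ^ K * E)) := mul_le_mul_of_nonneg_left herr (by positivity)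
      _ = (p : ℝ) ^ K * E := by rw [← mul_assoc, inv_mul_cancel₀ hpK, one_mul]
  rw [hE] at hB
  linarith

end LinForms

open LinForms in
/-- **Rung R11' — PROVED for every prime `p ≠ 3`**: strategies reading the input only through `K ≤ (log₂ n)^C` linear forms
mod `p` (arbitrary tables) win α's u-walk game on at most `θ·2ⁿ` inputs, `θ = (1 + θ_J)/2 < 1`. -/
theorem walkHardFLinForms (p : ℕ) [Fact p.Prime] (hp3 : p ≠ 3) : WalkHardFLinForms p := by
  classical
  obtain ⟨θJ, hθJ, HJ⟩ := walkHardFJunta p hp3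
  have hp2 : 2 ≤ p := (Fact.out : p.Prime).two_le
  have hpR : (2 : ℝ) ≤ p := by exact_mod_cast hp2
  set ρ : ℝ := Real.cos (Real.pi / (3 * p)) with hρ
  have hρ0 : 0 ≤ ρ := by
    apply Real.cos_nonneg_of_neg_pi_div_two_le_of_le
    · have : 0 ≤ Real.pi / (3 * p) := by positivity
      linarith [Real.pi_pos]
    · rw [div_le_div_iff₀ (by positivity) (by norm_num)]
      nlinarith [Real.pi_pos]
  have hρ1 : ρ < 1 := by
    rw [hρ, ← Real.cos_zero]
    apply Real.cos_lt_cos_of_nonneg_of_le_pi (le_refl 0)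
    · rw [div_le_iff₀ (by positivity)]; nlinarith [Real.pi_pos]
    · positivity
  -- `ρ^m < 1/p`, `ρ^{m₀} < (1 − θ_J)/(6√6)`
  obtain ⟨m, hm⟩ := exists_pow_lt_of_lt_one (show (0 : ℝ) < 1 / p by positivity) hρ1
  have h6 : (0 : ℝ) < 3 * Real.sqrt 6 := by positivity
  obtain ⟨m₀, hm₀⟩ := exists_pow_lt_of_lt_one (show (0 : ℝ) < (1 - θJ) / 2 / (3 * Real.sqrt 6) by
    apply div_pos (by linarith) h6) hρ1
  refine ⟨(1 + θJ) / 2, by linarith, fun C => ?_⟩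
  obtain ⟨n₁, hn₁⟩ := HJ (2 * C + 1)
  refine ⟨max n₁ (2 ^ (m + m₀ + 1)), fun n hn c K hK lam tab => ?_⟩
  have hn1 : n₁ ≤ n := le_trans (le_max_left _ _) hn
  have hn2 : 2 ^ (m + m₀ + 1) ≤ n := le_trans (le_max_right _ _) hn
  set ℓ := Nat.log 2 n with hℓ
  have hℓ1 : m + m₀ + 1 ≤ ℓ := Nat.le_log_of_pow_le one_lt_two hn2
  have hΛ1 : 1 ≤ ℓ ^ C := Nat.one_le_pow _ _ (by omega)
  -- the junta set
  set w := K * m + m₀ with hw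
  obtain ⟨J, hJcard, hreg⟩ := exists_regular_span lam w
  have hJsize : J.card ≤ Nat.log 2 n ^ (2 * C + 1) := by
    rw [← hℓ]
    have h1 : K * w ≤ ℓ ^ C * (ℓ ^ C * m + m₀) := by
      rw [hw]; exact Nat.mul_le_mul hK (by nlinarith)
    have h2 : ℓ ^ C * (ℓ ^ C * m + m₀) ≤ ℓ ^ C * (ℓ ^ C * (m + m₀)) := by
      apply Nat.mul_le_mul_left; nlinarith
    have h3 : ℓ ^ C * (ℓ ^ C * (m + m₀)) ≤ ℓ ^ C * (ℓ ^ C * ℓ) := by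
      apply Nat.mul_le_mul_left; apply Nat.mul_le_mul_left; omega
    calc J.card ≤ K * w := hJcard
      _ ≤ ℓ ^ C * (ℓ ^ C * ℓ) := h1.trans (h2.trans h3)
      _ = ℓ ^ (2 * C + 1) := by ring
  have hJbound : ∀ y : Fin (n + 1) → (Fin n → Bool) → Bool,
      (∀ g, ∀ u v : Fin n → Bool, (∀ i ∈ J, u i = v i) → y g u = y g v) →
      ((univ.filter fun u : Fin n → Bool => ringWinU c y u = true).card : ℝ) ≤ θJ * (2 : ℝ) ^ n :=
    fun y hy => hn₁ n hn1 c J hJsize y hy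
  have hq := card_win_le hp3 c lam tab J hreg hJbound
  -- the error term is at most `(1 − θ_J)/2 · 2ⁿ`
  have hρm : ρ ^ m ≤ 1 / p := hm.le
  have hpow : (p : ℝ) ^ K * ρ ^ w ≤ ρ ^ m₀ := by
    rw [hw, pow_add, mul_comm K m, pow_mul]
    have h1 : (ρ ^ m) ^ K ≤ (1 / (p : ℝ)) ^ K := pow_le_pow_left₀ (by positivity) hρm K
    have h2 : (p : ℝ) ^ K * (1 / (p : ℝ)) ^ K = 1 := by
      rw [← mul_pow, mul_one_div_cancel (by positivity), one_pow]
    calc (p : ℝ) ^ K * ((ρ ^ m) ^ K * ρ ^ m₀) = ((p : ℝ) ^ K * (ρ ^ m) ^ K) * ρ ^ m₀ := by ring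
      _ ≤ ((p : ℝ) ^ K * (1 / (p : ℝ)) ^ K) * ρ ^ m₀ := by
          apply mul_le_mul_of_nonneg_right _ (by positivity)
          exact mul_le_mul_of_nonneg_left h1 (by positivity)
      _ = ρ ^ m₀ := by rw [h2, one_mul]
  have herr : 3 * Real.sqrt 6 * (p : ℝ) ^ K * ρ ^ w * (2 : ℝ) ^ n ≤ (1 - θJ) / 2 * (2 : ℝ) ^ n := by
    have h2n : (0 : ℝ) ≤ (2 : ℝ) ^ n := by positivity
    have h1 : 3 * Real.sqrt 6 * ((p : ℝ) ^ K * ρ ^ w) ≤ 3 * Real.sqrt 6 * ρ ^ m₀ :=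
      mul_le_mul_of_nonneg_left hpow h6.le
    have h3 : 3 * Real.sqrt 6 * ρ ^ m₀ ≤ (1 - θJ) / 2 := by
      have := hm₀.le
      rw [le_div_iff₀ h6] at this
      linarith
    nlinarith
  linarith


end Summit.QuantumAdvantage.AdviceFreeQNC0

end
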